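import Literature.Barriers.HodgeConjecture.KaehlerCounterexamplesJTorus
import Literature.Geometry.Kaehler.ComplexTorusCover
import Literature.Geometry.Kaehler.AnalyticSet
import HarnessLib

/-!
# Zucker's Kähler counterexample: analytic curves of a torus lift to periodic curves of `ℂ²`

Third proof file of `Literature/Barriers/HodgeConjecture/KaehlerCounterexamples` (after
`KaehlerCounterexamplesProofs` — the fact implies de Rham's theorem on `ℂ²`, transport of
`J^*`-eigenclasses — and `KaehlerCounterexamplesJTorus` — the fact ASSEMBLED from de Rham's theorem
`exists_complexDeRhamIsoFamily (Fin 2 → ℂ)` and the absence of analytic hypersurfaces on the torus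
`T = ℂ²/Φ(ℤ^ι)` of a `J`-lattice, `Zucker1977_kaehlerTorus_noAnalyticCycles_of_leaves`). The one
geometric leaf — S. Zucker, *The Hodge conjecture for cubic fourfolds*, Compositio Math. 34 (1977),
Appendix B, Theorem p. 208: "the general `J`-torus `T` has no analytic subvarieties of dimension
`n`" (`n = 1`) — is a statement about the compact manifold `T`; every argument for it in print
(Zucker's: cycle classes of analytic curves and "no effective analytic cycle can be homologous to
zero on a compact Kähler manifold"; or theta functions / Appell–Humbert on the universal cover,
Lange–Birkenhake Ch. 2) starts by passing to the universal cover `π : ℂ² → T`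
(`ComplexTorus.cover Φ`), where an analytic curve `Z ⊂ T` becomes a CLOSED, `Φ(ℤ^ι)`-PERIODIC
subset `π⁻¹(Z) ⊂ ℂ²` which is again, near each of its points, the zero set of a holomorphic
function not vanishing identically there — an analytic hypersurface of the model space `ℂ²`
charted on itself, where holomorphy is ordinary complex differentiability and where the tree's
local theory of analytic sets and holomorphic chains (`Geometry/Kaehler/AnalyticSet*`,
`HolomorphicChain*`, stated on open subsets of a vector space) applies. This file PROVES that
passage and restates the geometric leaf upstairs:

* `IsAnalyticHypersurface.interior_eq_empty`, `.ne_univ`: an analytic hypersurface has empty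
  interior (identity principle built into the definition) and is a proper subset;
* `ComplexTorus.map_cover_nhds_eq`, `ComplexTorus.isOpenMap_cover`: the covering map is open
  (it is the inverse of every chart);
* `IsAnalyticHypersurface.preimage_cover`: **`π⁻¹(Z)` is an analytic hypersurface of `E`** (model
  space charted on itself) whenever `Z` is one of `T = E/Φ(ℤ^ι)`; `preimage_cover_add_latticeVec`:
  it is invariant under the lattice `Φ(ℤ^ι)`; `differentiableOn_of_preimage_cover`: its local
  equations are `ℂ`-differentiable functions on open subsets of `E`;
* `Zucker1977_kaehlerTorus_noAnalyticCycles_of_periodic`: **the fact from de Rham's theorem on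
  `ℂ²` and the absence of `Φ(ℤ^ι)`-periodic analytic hypersurfaces of `ℂ²`** for one `J`-lattice
  `Φ` (`Φ ∘ A = J ∘ Φ`), i.e. `Zucker1977_kaehlerTorus_noAnalyticCycles_of_leaves` with its
  geometric leaf moved to the universal cover;
* `IsAnalyticHypersurface.isAnalyticSet`: **an analytic hypersurface is an analytic subset** in
  the sense of the tree's `Literature.Geometry.Kaehler.IsAnalyticSet 𝓘(ℂ, E)`
  (`Geometry/Kaehler/AnalyticSet`: locally the common zero locus of finitely many holomorphic
  functions — here one), so that the tree's theory of analytic sets (regular and singular locus,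
  irreducible components, pure dimension, holomorphic chains) applies to `Z` and to its lift
  `π⁻¹(Z)` (`IsAnalyticHypersurface.isAnalyticSet_preimage_cover`).

No definition and no named fact is introduced (D-0026).

## References

* S. Zucker, Compositio Math. 34 (1977) 199–209, Appendix B, Theorem p. 208. [Zucker1977]
* H. Lange, Ch. Birkenhake, *Complex Abelian Varieties* (1992), §1.1.1, Lemma 1.1.3 (the
  universal cover `π : V → V/Λ`, a local biholomorphism). [LangeBirkenhake1992]
* Ph. Griffiths, J. Harris, *Principles of Algebraic Geometry* (1978), Ch. 0 §1 (analytic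
  hypersurfaces: local zero sets of holomorphic functions). [GriffithsHarrisPrinciples1978]
-/

noncomputable section

open scoped Manifold ContDiff Topology
open Set Filter

universe u

namespace Literature.Barriers.HodgeConjecture

open Literature.AlgebraicGeometry.HodgeTheory Literature.NumberTheory.Transcendental
  Literature.Geometry.Kaehler

/-! ### The covering map of a complex torus is open -/

section Cover

variable {ι : Type u} {E : Type u} [NormedAddCommGroup E] [NormedSpace ℂ E] [Fintype ι]
  (Φ : (ι → ℝ) ≃L[ℝ] E)

/-- Every point `z ∈ E` lies in the target box of the chart with corner `Φ⁻¹ z - (1/2, …, 1/2)`.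
[cite: LangeBirkenhake1992, Lemma 1.1.3] -/
theorem _root_.Literature.Geometry.Kaehler.ComplexTorus.mem_chart_target_self (z : E) :
    z ∈ (ComplexTorus.chart Φ (fun i ↦ Φ.symm z i - 2⁻¹)).target := by
  rw [ComplexTorus.chart_target]
  refine mem_preimage.2 (mem_univ_pi.2 fun i ↦ ⟨?_, ?_⟩) <;> linarith

/-- **The covering map is a local homeomorphism at every point, filter form**:
`map π (𝓝 z) = 𝓝 (π z)` (`π` is the inverse of the chart whose box contains `z`).
[cite: LangeBirkenhake1992, Lemma 1.1.3] -/
theorem _root_.Literature.Geometry.Kaehler.ComplexTorus.map_cover_nhds_eq (z : E) :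
    map (ComplexTorus.cover Φ) (𝓝 z) = 𝓝 (ComplexTorus.cover Φ z) := by
  have hz := ComplexTorus.mem_chart_target_self Φ z
  have h := (ComplexTorus.chart Φ (fun i ↦ Φ.symm z i - 2⁻¹)).symm.map_nhds_eq hz
  rwa [ComplexTorus.chart_symm_eq_cover] at h

/-- **The covering map `π : E → E/Φ(ℤ^ι)` is an open map.**
[cite: LangeBirkenhake1992, Lemma 1.1.3] -/
theorem _root_.Literature.Geometry.Kaehler.ComplexTorus.isOpenMap_cover :
    IsOpenMap (ComplexTorus.cover Φ) :=
  isOpenMap_iff_nhds_le.2 fun z ↦ (ComplexTorus.map_cover_nhds_eq Φ z).ge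

omit [Fintype ι] in
/-- The preimage of a set under the covering map is invariant under the lattice:
`z + Φ n ∈ π⁻¹(Z) ↔ z ∈ π⁻¹(Z)`. [cite: LangeBirkenhake1992, Lemma 1.1.3] -/
theorem _root_.Literature.Geometry.Kaehler.ComplexTorus.add_latticeVec_mem_preimage_cover
    (Z : Set (ComplexTorus Φ)) (z : E) (n : ι → ℤ) :
    z + ComplexTorus.latticeVec Φ n ∈ ComplexTorus.cover Φ ⁻¹' Z ↔
      z ∈ ComplexTorus.cover Φ ⁻¹' Z := by
  rw [mem_preimage, mem_preimage, ComplexTorus.cover_add_latticeVec]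

omit [Fintype ι] in
/-- **Lattice periodicity of preimages**: `π⁻¹(Z) + Φ n = π⁻¹(Z)` (as the image under the
translation `· + Φ n`). [cite: LangeBirkenhake1992, Lemma 1.1.3] -/
theorem _root_.Literature.Geometry.Kaehler.ComplexTorus.image_add_latticeVec_preimage_cover
    (Z : Set (ComplexTorus Φ)) (n : ι → ℤ) :
    (fun z ↦ z + ComplexTorus.latticeVec Φ n) '' (ComplexTorus.cover Φ ⁻¹' Z) =
      ComplexTorus.cover Φ ⁻¹' Z := by
  ext z
  constructor
  · rintro ⟨w, hw, rfl⟩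
    exact (ComplexTorus.add_latticeVec_mem_preimage_cover Φ Z w n).2 hw
  · intro hz
    refine ⟨z - ComplexTorus.latticeVec Φ n, ?_, sub_add_cancel _ _⟩
    rw [mem_preimage, ComplexTorus.cover_sub_latticeVec]
    exact hz

end Cover

/-! ### Elementary properties of analytic hypersurfaces -/

section Elementary

variable {E : Type u} [NormedAddCommGroup E] [NormedSpace ℂ E]
variable {M : Type u} [TopologicalSpace M] [ChartedSpace E M]

/-- **An analytic hypersurface has empty interior**: at an interior point `x` of `Z` the local
equation `f` of `Z` would vanish on the neighbourhood `Z ∩ U` of `x`, against `¬ f =ᶠ[𝓝 x] 0`.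
[cite: GriffithsHarrisPrinciples1978, Ch. 0 §1] -/
theorem IsAnalyticHypersurface.interior_eq_empty {Z : Set M}
    (hZ : IsAnalyticHypersurface (E := E) Z) :
    interior Z = ∅ := by
  refine eq_empty_iff_forall_notMem.2 fun x hx ↦ ?_
  obtain ⟨U, hU, hxU, f, -, hf0, hZU⟩ := hZ.2.2 x (interior_subset hx)
  refine hf0 ?_
  have hmem : Z ∩ U ∈ 𝓝 x := inter_mem (mem_interior_iff_mem_nhds.1 hx) (hU.mem_nhds hxU)
  filter_upwards [hmem] with y hy
  have hy' : y ∈ U ∩ f ⁻¹' {0} := hZU ▸ hy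
  exact hy'.2

/-- An analytic hypersurface is a proper subset (it is non-empty with empty interior).
[cite: GriffithsHarrisPrinciples1978, Ch. 0 §1] -/
theorem IsAnalyticHypersurface.ne_univ {Z : Set M} (hZ : IsAnalyticHypersurface (E := E) Z) :
    Z ≠ univ := by
  intro h
  have hne : (interior Z).Nonempty := by
    rw [h, interior_univ]
    exact ⟨hZ.2.1.some, mem_univ _⟩
  rw [hZ.interior_eq_empty] at hne
  exact Set.not_nonempty_empty hne

/-- The local equation of an analytic hypersurface vanishes at the points of the hypersurface in
its domain. [cite: GriffithsHarrisPrinciples1978, Ch. 0 §1] -/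
theorem IsAnalyticHypersurface.apply_eq_zero {α : Type*} {Z U : Set α} {f : α → ℂ}
    (hZU : Z ∩ U = U ∩ f ⁻¹' {0}) {y : α} (hy : y ∈ Z) (hyU : y ∈ U) : f y = 0 := by
  have h : y ∈ U ∩ f ⁻¹' {0} := hZU ▸ ⟨hy, hyU⟩
  exact h.2

end Elementary

/-! ### Lifting analytic hypersurfaces to the universal cover -/

section Lift

variable {ι : Type u} {E : Type u} [NormedAddCommGroup E] [NormedSpace ℂ E] [Fintype ι]
  (Φ : (ι → ℝ) ≃L[ℝ] E)

/-- **An analytic hypersurface of the torus lifts to an analytic hypersurface of the model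
space.** If `Z ⊂ T = E/Φ(ℤ^ι)` is an analytic hypersurface then so is `π⁻¹(Z) ⊂ E` (`E` charted
on itself): it is closed (`π` continuous), non-empty (`π` onto), and near `z ∈ π⁻¹(Z)` it is cut
out, on `π⁻¹(U)`, by `f ∘ π` for the local equation `f` of `Z` on `U ∋ π z` — holomorphic as `π`
is (`ComplexTorus.mdifferentiable_cover`), and not identically zero near `z` because `π` maps the
neighbourhoods of `z` onto the neighbourhoods of `π z` (`ComplexTorus.map_cover_nhds_eq`).
Lange–Birkenhake (1992), §1.1.1: analytic subvarieties of `X = V/Λ` "correspond to"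
`Λ`-periodic analytic subvarieties of `V`. [cite: LangeBirkenhake1992, §1.1.1 and Lemma 1.1.3]
[cite: Zucker1977, Appendix B Theorem p. 208] -/
theorem IsAnalyticHypersurface.preimage_cover {Z : Set (ComplexTorus Φ)}
    (hZ : IsAnalyticHypersurface (E := E) Z) :
    IsAnalyticHypersurface (E := E) (M := E) (ComplexTorus.cover Φ ⁻¹' Z) := by
  refine ⟨hZ.1.preimage (ComplexTorus.continuous_cover Φ), ?_, fun z hz ↦ ?_⟩
  · obtain ⟨x, hx⟩ := hZ.2.1
    obtain ⟨z, rfl⟩ := ComplexTorus.cover_surjective Φ x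
    exact ⟨z, hx⟩
  · obtain ⟨U, hU, hxU, f, hf, hf0, hZU⟩ := hZ.2.2 (ComplexTorus.cover Φ z) hz
    refine ⟨ComplexTorus.cover Φ ⁻¹' U, hU.preimage (ComplexTorus.continuous_cover Φ), hxU,
      f ∘ ComplexTorus.cover Φ,
      hf.comp ((ComplexTorus.mdifferentiable_cover Φ).mdifferentiableOn) subset_rfl, ?_, ?_⟩
    · intro h0
      apply hf0
      have h1 : ∀ᶠ y in map (ComplexTorus.cover Φ) (𝓝 z), f y = (0 : (ComplexTorus Φ) → ℂ) y :=
        eventually_map.2 h0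
      rwa [ComplexTorus.map_cover_nhds_eq] at h1
    · ext w
      simp only [mem_inter_iff, mem_preimage, Function.comp_apply, mem_singleton_iff]
      constructor
      · rintro ⟨hwZ, hwU⟩
        exact ⟨hwU, IsAnalyticHypersurface.apply_eq_zero hZU hwZ hwU⟩
      · rintro ⟨hwU, hw0⟩
        have h : ComplexTorus.cover Φ w ∈ U ∩ f ⁻¹' {0} := ⟨hwU, hw0⟩
        rw [← hZU] at h
        exact ⟨h.1, hwU⟩

/-- In the model space charted on itself the local equations of an analytic hypersurface are
ordinary `ℂ`-differentiable functions on open sets: every `z ∈ Z` has an open `U ∋ z` and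
`g : E → ℂ`, `ℂ`-differentiable on `U`, not identically zero near `z`, with
`Z ∩ U = U ∩ g⁻¹(0)`. [cite: GriffithsHarrisPrinciples1978, Ch. 0 §1] -/
theorem IsAnalyticHypersurface.exists_differentiableOn {Z : Set E}
    (hZ : IsAnalyticHypersurface (E := E) (M := E) Z) {z : E} (hz : z ∈ Z) :
    ∃ U : Set E, IsOpen U ∧ z ∈ U ∧ ∃ g : E → ℂ, DifferentiableOn ℂ g U ∧ ¬ (g =ᶠ[𝓝 z] 0) ∧
      Z ∩ U = U ∩ g ⁻¹' {0} := by
  obtain ⟨U, hU, hzU, g, hg, hg0, hZU⟩ := hZ.2.2 z hz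
  exact ⟨U, hU, hzU, g, hg.differentiableOn, hg0, hZU⟩

/-- Conversely, closed non-empty subsets of `E` cut out locally by `ℂ`-differentiable equations
(not identically zero at the point) are analytic hypersurfaces of the model space.
[cite: GriffithsHarrisPrinciples1978, Ch. 0 §1] -/
theorem IsAnalyticHypersurface.of_differentiableOn {Z : Set E} (h₁ : IsClosed Z)
    (h₂ : Z.Nonempty)
    (h₃ : ∀ z ∈ Z, ∃ U : Set E, IsOpen U ∧ z ∈ U ∧ ∃ g : E → ℂ, DifferentiableOn ℂ g U ∧
      ¬ (g =ᶠ[𝓝 z] 0) ∧ Z ∩ U = U ∩ g ⁻¹' {0}) :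
    IsAnalyticHypersurface (E := E) (M := E) Z := by
  refine ⟨h₁, h₂, fun z hz ↦ ?_⟩
  obtain ⟨U, hU, hzU, g, hg, hg0, hZU⟩ := h₃ z hz
  exact ⟨U, hU, hzU, g, hg.mdifferentiableOn, hg0, hZU⟩

/-- **The lift of an analytic hypersurface of the torus, all properties together**: `π⁻¹(Z)` is
an analytic hypersurface of `E` invariant under every lattice translation.
[cite: LangeBirkenhake1992, §1.1.1] [cite: Zucker1977, Appendix B Theorem p. 208] -/
theorem IsAnalyticHypersurface.exists_periodic_lift {Z : Set (ComplexTorus Φ)}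
    (hZ : IsAnalyticHypersurface (E := E) Z) :
    ∃ W : Set E, IsAnalyticHypersurface (E := E) (M := E) W ∧
      (∀ n : ι → ℤ, (fun z ↦ z + ComplexTorus.latticeVec Φ n) '' W = W) ∧
        W = ComplexTorus.cover Φ ⁻¹' Z :=
  ⟨ComplexTorus.cover Φ ⁻¹' Z, hZ.preimage_cover Φ,
    ComplexTorus.image_add_latticeVec_preimage_cover Φ Z, rfl⟩

/-- **No periodic analytic hypersurface upstairs, no analytic hypersurface downstairs.** If `E`
contains no analytic hypersurface invariant under all the lattice translations `· + Φ n`,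
`n ∈ ℤ^ι`, then the torus `E/Φ(ℤ^ι)` contains no analytic hypersurface.
[cite: LangeBirkenhake1992, §1.1.1] [cite: Zucker1977, Appendix B Theorem p. 208] -/
theorem not_isAnalyticHypersurface_of_periodic
    (h : ∀ W : Set E, (∀ n : ι → ℤ, (fun z ↦ z + ComplexTorus.latticeVec Φ n) '' W = W) →
      ¬ IsAnalyticHypersurface (E := E) (M := E) W)
    (Z : Set (ComplexTorus Φ)) : ¬ IsAnalyticHypersurface (E := E) Z := fun hZ ↦
  h _ (ComplexTorus.image_add_latticeVec_preimage_cover Φ Z) (hZ.preimage_cover Φ)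

end Lift

/-! ### The fact from de Rham's theorem and the absence of periodic analytic curves in `ℂ²` -/

/-- **Zucker's counterexample, with its geometric leaf on the universal cover.** Let
`Φ : ℝ^ι ≃ ℂ²` be a `J`-lattice (`Φ ∘ A = J ∘ Φ` for an integer matrix `A`,
`J(z, w) = (iz, -iw)` = `Zucker.J`). ASSUME (1) de Rham's theorem with complex coefficients for
manifolds charted on `ℂ²` (the named fact `exists_complexDeRhamIsoFamily (Fin 2 → ℂ)`, which the
fact implies back) and (2) that `ℂ²` contains no `Φ(ℤ^ι)`-periodic analytic hypersurface (the lift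
of Zucker's Theorem, Appendix B p. 208: the general `J`-torus has no analytic curve). THEN the
barrier fact holds — by `Zucker1977_kaehlerTorus_noAnalyticCycles_of_leaves` (cohomological half,
proved in `KaehlerCounterexamplesJTorus`) and `not_isAnalyticHypersurface_of_periodic`.
[cite: Zucker1977, Appendix B Theorem p. 208] -/
theorem Zucker1977_kaehlerTorus_noAnalyticCycles_of_periodic {ι : Type} [Fintype ι]
    (Φ : (ι → ℝ) ≃L[ℝ] (Fin 2 → ℂ)) (A : Matrix ι ι ℤ)
    (hA : ∀ x : ι → ℝ, Φ ((A.map (Int.cast : ℤ → ℝ)).mulVec x) = Zucker.J (Φ x))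
    (h₁ : exists_complexDeRhamIsoFamily (Fin 2 → ℂ))
    (h₂ : ∀ W : Set (Fin 2 → ℂ),
      (∀ n : ι → ℤ, (fun z ↦ z + ComplexTorus.latticeVec Φ n) '' W = W) →
        ¬ IsAnalyticHypersurface (E := Fin 2 → ℂ) (M := Fin 2 → ℂ) W) :
    Zucker1977_kaehlerTorus_noAnalyticCycles :=
  Zucker1977_kaehlerTorus_noAnalyticCycles_of_leaves Φ A hA h₁
    (not_isAnalyticHypersurface_of_periodic Φ h₂)

/-! ### Analytic hypersurfaces are analytic subsets (bridge to `Geometry/Kaehler/AnalyticSet`) -/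

section Bridge

variable {E : Type u} [NormedAddCommGroup E] [NormedSpace ℂ E]
variable {M : Type u} [TopologicalSpace M] [ChartedSpace E M]

/-- An analytic hypersurface is analytic (one local holomorphic equation) at each of its points,
in the sense of `IsAnalyticSetAt 𝓘(ℂ, E)`. [cite: GriffithsHarrisPrinciples1978, Ch. 0 §1] -/
theorem IsAnalyticHypersurface.isAnalyticSetAt_of_mem {Z : Set M}
    (hZ : IsAnalyticHypersurface (E := E) Z) {x : M} (hx : x ∈ Z) :
    IsAnalyticSetAt 𝓘(ℂ, E) Z x := by
  obtain ⟨U, hU, hxU, f, hf, -, hZU⟩ := hZ.2.2 x hx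
  refine IsAnalyticSetAt.of_fintype (ι := Fin 1) hU hxU (fun y _ ↦ f y) (fun _ ↦ hf) ?_
  rw [hZU]
  congr 1
  ext y
  simp only [mem_preimage, mem_singleton_iff, mem_setOf_eq, forall_const]

/-- **An analytic hypersurface is an analytic subset** of `M` (`IsAnalyticSet 𝓘(ℂ, E)`: near
EVERY point of `M` the common zero locus of finitely many holomorphic functions): at its own
points by the local equation, elsewhere vacuously since it is closed
(`IsAnalyticSetAt.of_notMem_closure`). Griffiths–Harris, Ch. 0 §1: "an analytic hypersurface
… is an analytic variety". [cite: GriffithsHarrisPrinciples1978, Ch. 0 §1] -/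
theorem IsAnalyticHypersurface.isAnalyticSet {Z : Set M} (hZ : IsAnalyticHypersurface (E := E) Z) :
    IsAnalyticSet 𝓘(ℂ, E) Z := fun x ↦ by
  by_cases hx : x ∈ Z
  · exact hZ.isAnalyticSetAt_of_mem hx
  · exact IsAnalyticSetAt.of_notMem_closure (I := 𝓘(ℂ, E)) (by rwa [hZ.1.closure_eq])

/-- The lift `π⁻¹(Z) ⊂ E` of an analytic hypersurface of the torus `E/Φ(ℤ^ι)` is an analytic
subset of the model space `E` (charted on itself, model `𝓘(ℂ, E)`), where the tree's local
theory of analytic sets is available. [cite: LangeBirkenhake1992, §1.1.1]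
[cite: GriffithsHarrisPrinciples1978, Ch. 0 §1] -/
theorem IsAnalyticHypersurface.isAnalyticSet_preimage_cover {ι : Type u} [Fintype ι]
    (Φ : (ι → ℝ) ≃L[ℝ] E) {Z : Set (ComplexTorus Φ)} (hZ : IsAnalyticHypersurface (E := E) Z) :
    IsAnalyticSet 𝓘(ℂ, E) (ComplexTorus.cover Φ ⁻¹' Z) :=
  (hZ.preimage_cover Φ).isAnalyticSet

end Bridge

end Literature.Barriers.HodgeConjecture

end
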